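import Summits.AnomalousDissipation.AnomalousDissipation.Theorems.TameRoughRigidityGPEulerCoerciveStubGalerkinTail
import HarnessLib

/-!
# Stub `stub_galerkinTailLocal` (T′) of line `floor_duality_galerkin` (crux stmt-AnomalousDissipation-18400,
  `TameRoughRigidity.GPEulerCoercive`) — Galerkin tail absorption with a STATE-DEPENDENT strain budget

RESHAPE OF T (lead, cycle 1). The landed tail lemma T (`stub_galerkinTail`,
`…StubGalerkinTail.lean`) charges the unresolved tail `z = v − P_M v` through ONE global strain bound
`S` of all differentials `Ψ'(·)`, so the Galerkin certificate it asks for carries the penalty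
`S²|y|²/(λ_M − S)` at EVERY Galerkin point `y` — also far out, where a compactly supported cylindrical
`Ψ` is silent (`Ψ'(y) = 0`) and the certificate must read `Γ + S²|y|²/(λ_M − S) ≤ ‖∇y‖²`; on the first
shell `‖∇y‖² = 4π²|y|²`, which forces `S²/(λ_M − S) ≤ 4π²`, i.e. `S ≲ 4π²M`, and caps the level of any
rung at resolution `M` linearly in `M` (lead notes). But the tail estimate is POINTWISE in the state:
at the point `y` only the strain of the one field `Ψ'(y)` is paid. This file proves the local form T′:
with a state-dependent budget `S(y)` (`|⟨∇Ψ'(v)(x) e, e⟩| ≤ S(v)|e|²`, `0 ≤ S(·) < λ_M`) the Galerkin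
certificate `Γ + S(y)²|y|²/(λ_M − S(y)) ≤ ‖∇y‖² + ⟨f − B(y,y), Ψ'(y)⟩` on `H ∩ galerkinSpace M` still
lifts to the floor certificate `Γ ≤ ‖∇v‖² + ⟨f − B(v,v), Ψ'(v)⟩` at every finite-enstrophy `v ∈ H`.
The penalty now vanishes wherever `Ψ` is silent, so the far field costs nothing and the only coupling
left is `S(y) < λ_M` where the certificate is active. T is the special case `S ≡ const`.

## Proof

Verbatim the proof of T (all helpers are imported from the landed file): `y = P_M v ∈ H`,
`Ψ.grad v = Ψ.grad y` (low-mode hypothesis), spectral Pythagoras and the tail gap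
`‖∇z‖² ≥ λ_M|z|²` (`toReal_eGradNormSq_split`), and the inertial tail estimate
(`inertialPairing_sub_galerkinProj_ge`) — applied with the constant `S(y)` of the ONE field
`Ψ'(y) = Ψ'(v)` that occurs.

## References

* C. Foias, O. Manley, R. Rosa, R. Temam, *Navier–Stokes Equations and Turbulence* (CUP 2001),
  Ch. IV §1.1 (1.7)–(1.11), §1.2 (1.30).
* J. C. Robinson, J. L. Rodrigo, W. Sadowski, *The Three-Dimensional Navier–Stokes Equations* (CUP 2016),
  §4.1, Lemma 4.1 (Galerkin truncation = Fourier truncation; tail estimates).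
-/

-- `Summit.<Summit>.<Problem>` is the tree's mandated summit-side namespace (CONVENTIONS §2); single-conjunct summit, duplicate deliberate.
set_option linter.dupNamespace false

noncomputable section

namespace Summit.AnomalousDissipation.AnomalousDissipation.Theorems.TameRoughRigidity.GPEulerCoercive

open MeasureTheory Filter Topology UnitAddTorus
open scoped InnerProductSpace RealInnerProductSpace ENNReal NNReal
open Literature.Analysis.FunctionSpaces Literature.Analysis.FluidPDE

/-- Local notation: real vector fields on `T³`. -/
local notation "Vec3" => (UnitAddTorus (Fin 3)) → (EuclideanSpace ℝ (Fin 3))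
/-- Local notation: `L²(T³; ℝ³)`. -/
local notation "L2" => (Lp (EuclideanSpace ℝ (Fin 3)) 2 (volume : Measure (UnitAddTorus (Fin 3))))
/-- Local notation: the energy space `H`. -/
local notation "H3" => (Torus.energySpace (Fin 3))

/-- The spectral enstrophy only depends on the a.e. class of the field (private copy, as in the
landed T file, of the import-unreachable Literature survivor). [folklore] -/
private theorem eGradNormSq_congr_ae' {v w : Vec3} (h : v =ᵐ[volume] w) :
    Torus.eGradNormSq v = Torus.eGradNormSq w := by
  rw [Torus.eGradNormSq_eq_tsum, Torus.eGradNormSq_eq_tsum]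
  simp_rw [Torus.mFourierCoeff_congr_ae (h.fun_comp EuclideanSpace.complexify)]

/-! ### The stub -/

/-- **T′ `stub_galerkinTailLocal`** — GALERKIN TAIL ABSORPTION WITH A STATE-DEPENDENT STRAIN BUDGET
(registered stub of line `floor_duality_galerkin`, crux stmt-AnomalousDissipation-18400; reshape of
the landed T `stub_galerkinTail`, which is the case `S ≡ const`). Let the cylindrical `Ψ` read only
the Galerkin modes of order `M` (`(v, gᵢ) = (P_M v, gᵢ)` for all `v ∈ L²`) and let the differential
at each state obey the pointwise strain bound `|⟨∇Ψ'(v)(x) e, e⟩| ≤ S(v)|e|²` with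
`0 ≤ S(v) < λ_M := 4π²(M² + 1)`. If the Galerkin certificate
`Γ + S(y)²|y|²/(λ_M − S(y)) ≤ ‖∇y‖² + ⟨f − B(y,y), Ψ'(y)⟩` holds at every `y ∈ H ∩ galerkinSpace M`,
then the floor certificate `Γ ≤ ‖∇v‖² + ⟨f − B(v,v), Ψ'(v)⟩` holds at every finite-enstrophy
`v ∈ H`. Proof: as for T — `y = P_M v ∈ H`, `Ψ.grad v = Ψ.grad y`; `‖∇v‖² = ‖∇y‖² + ‖∇z‖²`,
`‖∇z‖² ≥ λ_M|z|²` (`toReal_eGradNormSq_split`); the inertial tail costs at most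
`S(y)²|y|²/(λ_M − S(y)) + λ_M|z|²` (`inertialPairing_sub_galerkinProj_ge` with the budget of the one
field `Ψ'(y)`); add up. [folklore] -/
theorem stub_galerkinTailLocal (f : Vec3) (M : ℕ) (Γ : ℝ) (S : H3 → ℝ)
    (Ψ : Torus.CylindricalTest (Fin 3))
    (hlow : ∀ (v : L2) (i : Fin Ψ.m),
      Torus.pairing v (Ψ.g i) = Torus.pairing ((Torus.galerkinProj M : L2 →L[ℝ] L2) v) (Ψ.g i))
    (hstrain : ∀ (v : H3) (x : UnitAddTorus (Fin 3)) (e : EuclideanSpace ℝ (Fin 3)),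
      |⟪Torus.fderiv (Ψ.grad v) x e, e⟫_ℝ| ≤ S v * ‖e‖ ^ 2)
    (hS : ∀ v : H3, 0 ≤ S v) (hSM : ∀ v : H3, S v < 4 * Real.pi ^ 2 * ((M : ℝ) ^ 2 + 1))
    (hgal : ∀ y : H3, (y : L2) ∈ (Torus.galerkinSpace M : Submodule ℝ L2) →
      Γ + S y ^ 2 * ‖y‖ ^ 2 / (4 * Real.pi ^ 2 * ((M : ℝ) ^ 2 + 1) - S y) ≤
        (Torus.eGradNormSq ((y : L2) : Vec3)).toReal + Torus.nsGeneratorPairing 0 f y (Ψ.grad y)) :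
    ∀ v : H3, Torus.eGradNormSq ((v : L2) : Vec3) ≠ ⊤ →
      Γ ≤ (Torus.eGradNormSq ((v : L2) : Vec3)).toReal + Torus.nsGeneratorPairing 0 f v (Ψ.grad v) := by
  intro v hfin
  -- the Galerkin part `y = P_M v ∈ H`
  have hPv : (Torus.galerkinProj M : L2 →L[ℝ] L2) (v : L2) ∈
      (Torus.galerkinSpace M : Submodule ℝ L2) := Torus.galerkinProj_apply_mem M (v : L2)
  obtain ⟨y, hyv⟩ : ∃ y : H3, (y : L2) = (Torus.galerkinProj M : L2 →L[ℝ] L2) (v : L2) :=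
    ⟨⟨_, Torus.galerkinSpace_le_energySpace_holds M hPv⟩, rfl⟩
  have hPy : (y : L2) ∈ (Torus.galerkinSpace M : Submodule ℝ L2) := hyv ▸ hPv
  -- (a) `Ψ` does not see the tail: coordinates, hence differentials, agree at `v` and `y`
  have hcoords : Ψ.coords v = Ψ.coords y := by
    unfold Torus.CylindricalTest.coords
    rw [hyv]
    congr 1
    funext i
    exact hlow (v : L2) i
  have hgrad : Ψ.grad y = Ψ.grad v := by
    unfold Torus.CylindricalTest.grad
    rw [hcoords]
  have hw : Torus.IsSmooth (Ψ.grad v) := Torus.CylindricalTest.isSmooth_grad_holds Ψ v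
  -- (b) representatives: `P_M v = T_M v` a.e.
  have hu2 : MemLp ((v : L2) : Vec3) 2 volume := Lp.memLp (v : L2)
  have hae : ((y : L2) : Vec3) =ᵐ[volume] Torus.fourierTruncate M ((v : L2) : Vec3) := by
    rw [hyv]
    exact Torus.coeFn_galerkinProj_of_mem v.2 M
  have hGy : Torus.eGradNormSq ((y : L2) : Vec3) =
      Torus.eGradNormSq (Torus.fourierTruncate M ((v : L2) : Vec3)) := eGradNormSq_congr_ae' hae
  have hYn : ‖y‖ ^ 2 = ∫ x, ‖Torus.fourierTruncate M ((v : L2) : Vec3) x‖ ^ 2 := by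
    rw [Submodule.coe_norm, ← Torus.integral_norm_sq_coe_eq]
    exact integral_congr_ae (by filter_upwards [hae] with x hx; rw [hx])
  -- (c) enstrophy splitting and tail gap; (d) inertial tail estimate
  obtain ⟨hGsplit, hgap⟩ := toReal_eGradNormSq_split hu2 hfin M
  have hstrain' : ∀ (x : UnitAddTorus (Fin 3)) (e : EuclideanSpace ℝ (Fin 3)),
      |⟪Torus.fderiv (Ψ.grad v) x e, e⟫_ℝ| ≤ S y * ‖e‖ ^ 2 := fun x e => hgrad ▸ hstrain y x e
  have hin := inertialPairing_sub_galerkinProj_ge v.2 M hw hstrain' (hS y) (hSM y)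
  -- (e) the Galerkin certificate at `y`, and the endgame
  have hcert := hgal y hPy
  rw [hgrad, hGy, hYn] at hcert
  simp only [Torus.nsGeneratorPairing, zero_mul, add_zero] at hcert ⊢
  rw [hyv] at hcert
  have hP : S y ^ 2 * (∫ x, ‖Torus.fourierTruncate M ((v : L2) : Vec3) x‖ ^ 2) /
      (4 * Real.pi ^ 2 * ((M : ℝ) ^ 2 + 1) - S y) =
        S y ^ 2 / (4 * Real.pi ^ 2 * ((M : ℝ) ^ 2 + 1) - S y) *
          ∫ x, ‖Torus.fourierTruncate M ((v : L2) : Vec3) x‖ ^ 2 := by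
    ring
  rw [hP] at hcert
  linarith [hcert, hin, hgap, hGsplit]

end Summit.AnomalousDissipation.AnomalousDissipation.Theorems.TameRoughRigidity.GPEulerCoercive

end
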